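import Summits.QuantumFields.YangMills.Theorems.ParabolicTrajectoryLatticeGapOnTrajectoryStubOddRPCrossTilt
import Summits.QuantumFields.YangMills.Theorems.ParabolicTrajectoryLatticeGapOnTrajectoryStubTiltChessboardStep
import Summits.QuantumFields.YangMills.Theorems.ParabolicTrajectoryLatticeGapOnTrajectoryStubTiltChessboard
import Summits.QuantumFields.YangMills.Theorems.ParabolicTrajectoryLatticeGapOnTrajectoryStubLargeFieldSparseOfChessboard
import HarnessLib

/-!
# Large-field sparseness of Wilson's lattice gauge measure on odd four-tori (every compact `G`)

Crux `Summit.QuantumFields.YangMills.Theses.ParabolicTrajectory.LatticeGapOnTrajectory`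
(stmt-QuantumFields-10523), line `line-sparse-defect-orbit-window` (lead a4): the planner's stub
`stub_largeFieldSparseness` (`∀ G r, LargeFieldSparse r`) in closed, definition-free form, assembled
from the four landed stubs of the lead's reshape:

* (A) `stub_oddRPCrossTilt` — Osterwalder–Seiler positivity on the odd torus with a crossing tilt
  (net crossing couplings `β − t_p ∈ [0, β]`);
* (B) `stub_tiltChessboardStep` — the one-direction chessboard for exponential tilt functionals of one
  plaquette orientation class (Fröhlich–Israel–Lieb–Simon maximisation on the odd cycle,
  `OddCycle.chessboard`; the temporal class uses the reflection `t ↦ 2 − t`);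
* (C) `stub_tiltChessboard` — all four directions by the axis symmetry of the Wilson measure;
* (D) `stub_largeFieldSparse_of_chessboard` — Chebyshev tilt `t = β`, pigeonhole to one orientation
  class, and the crude free-energy lower bound `exp_mul_pow_le_partitionFunction_toReal`
  (Haar small-ball positivity).

## Main result

* `largeFieldSparse` — for every compact group `G` with a faithful continuous unitary lattice
  representation `r` and every threshold `ε₀ > 0` there are `c > 0`, `b₀`, `S₀` such that for all
  `β ≥ b₀`, all odd tori `(2S+1)⁴` with `S ≥ S₀` and ALL finite plaquette sets `X`:
  `μ_{β}(every p ∈ X has N − Re tr r(U_p) ≥ ε₀) ≤ exp(−c β |X|)` — a prescribed set of `ε₀`-large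
  plaquettes is jointly exponentially rare in `β`, per plaquette, uniformly in the volume
  (Bałaban's large-field suppression, CMP 122 (1989) (0.35)–(0.37), in chessboard form; the only
  group-theoretic input is positivity of Haar measure on open sets). The constants delivered by (D):
  `c = ε₀/24`, `S₀ = 1`.

This is the body of `LargeFieldSparse r` (skeleton `Cruxes/LatticeGapOnTrajectory/Lines/
sparse_defect_orbit_window.lean`), which unfolds to it definitionally.
-/

set_option autoImplicit false

noncomputable section

namespace Summit.QuantumFields.YangMills.Cruxes.LatticeGapOnTrajectory.SparseDefectOrbitWindow

open scoped BigOperators ENNReal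
open MeasureTheory Literature.MathematicalPhysics.QuantumFieldTheory

/-- **Large-field sparseness under Wilson's torus measure, every compact gauge group.** For every
faithful continuous unitary lattice representation `r` of a compact group `G` and every `ε₀ > 0`
there are `c > 0`, `b₀ : ℝ`, `S₀ : ℕ` such that for all `β ≥ b₀`, all `S ≥ S₀` and all finite sets
`X` of plaquettes of the odd torus `(ℤ/(2S+1))⁴`, the Wilson probability that every plaquette of `X`
has plaquette energy `N − Re tr r(U_p) ≥ ε₀` is at most `exp(−c β |X|)`. Composition of the four
landed stubs (A)–(D) of line `line-sparse-defect-orbit-window`. -/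
theorem largeFieldSparse :
    ∀ (G : Type) [Group G] [TopologicalSpace G] [IsTopologicalGroup G] [CompactSpace G]
      [MeasurableSpace G] [BorelSpace G] (r : LatticeRep G),
    ∀ ε₀ : ℝ, 0 < ε₀ → ∃ (c b₀ : ℝ) (S₀ : ℕ), 0 < c ∧ ∀ β : ℝ, b₀ ≤ β → ∀ S : ℕ, S₀ ≤ S →
      ∀ X : Finset (Plaquette 4 (2 * S + 1)),
        (wilsonMeasure r.ρ β : Measure (GaugeConfig 4 (2 * S + 1) G))
            {U | ∀ p ∈ X, ε₀ ≤ (r.N : ℝ) - (r.ρ (plaquetteHolonomy U p.1 p.2.1.1 p.2.1.2)).trace.re} ≤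
          ENNReal.ofReal (Real.exp (-(c * β * X.card))) :=
  stub_largeFieldSparse_of_chessboard (stub_tiltChessboard (stub_tiltChessboardStep stub_oddRPCrossTilt))

/-- **The four-direction tilt chessboard on the odd four-torus, unconditionally** (hypotheses of
(C) discharged by (B) ∘ (A)): for `S ≥ 1`, continuous `ρ`, `β ≥ 0`, a plaquette orientation class `o`
and a tilt profile `0 ≤ c ≤ β` on the sites,
`(E_β exp(−∑ₓ c(x) Re tr ρ(U_{(x,o)})))^{(2S+1)⁴} ≤ ∏_y E_β exp(−c(y) ∑ₓ Re tr ρ(U_{(x,o)}))`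
(Fröhlich–Israel–Lieb–Simon's chessboard estimate, in the tilt form that survives on odd tori). -/
theorem tiltChessboard :
    ∀ (S N : ℕ) (G : Type) [Group G] [TopologicalSpace G] [IsTopologicalGroup G] [CompactSpace G]
      [MeasurableSpace G] [BorelSpace G] (ρ : G →* Matrix (Fin N) (Fin N) ℂ), 1 ≤ S → Continuous ρ →
    ∀ (β : ℝ), 0 ≤ β → ∀ (o : {q : Fin 4 × Fin 4 // q.1 < q.2}) (c : Site 4 (2 * S + 1) → ℝ),
      (∀ x, 0 ≤ c x) → (∀ x, c x ≤ β) →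
      (∫ U, Real.exp (-∑ x : Site 4 (2 * S + 1), c x * WilsonRP.plaqRe ρ U (x, o))
          ∂(wilsonMeasure ρ β : Measure (GaugeConfig 4 (2 * S + 1) G))) ^ ((2 * S + 1) ^ 4) ≤
        ∏ y : Site 4 (2 * S + 1),
          ∫ U, Real.exp (-∑ x : Site 4 (2 * S + 1), c y * WilsonRP.plaqRe ρ U (x, o))
            ∂(wilsonMeasure ρ β : Measure (GaugeConfig 4 (2 * S + 1) G)) :=
  stub_tiltChessboard (stub_tiltChessboardStep stub_oddRPCrossTilt)

/-- **The one-direction tilt chessboard on the odd four-torus, unconditionally** ((B) with (A)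
discharged): `(E_β exp(−∑ₓ c(x) Re tr ρ(U_{(x,o)})))^{2S+1} ≤ ∏ₛ E_β exp(−∑ₓ c(x[0 := s]) Re tr ρ(U_{(x,o)}))`. -/
theorem tiltChessboardStep :
    ∀ (S N : ℕ) (G : Type) [Group G] [TopologicalSpace G] [IsTopologicalGroup G] [CompactSpace G]
      [MeasurableSpace G] [BorelSpace G] (ρ : G →* Matrix (Fin N) (Fin N) ℂ), 1 ≤ S → Continuous ρ →
    ∀ (β : ℝ), 0 ≤ β → ∀ (o : {q : Fin 4 × Fin 4 // q.1 < q.2}) (c : Site 4 (2 * S + 1) → ℝ),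
      (∀ x, 0 ≤ c x) → (∀ x, c x ≤ β) →
      (∫ U, Real.exp (-∑ x : Site 4 (2 * S + 1), c x * WilsonRP.plaqRe ρ U (x, o))
          ∂(wilsonMeasure ρ β : Measure (GaugeConfig 4 (2 * S + 1) G))) ^ (2 * S + 1) ≤
        ∏ s : ZMod (2 * S + 1),
          ∫ U, Real.exp (-∑ x : Site 4 (2 * S + 1),
              c (Function.update x 0 s) * WilsonRP.plaqRe ρ U (x, o))
            ∂(wilsonMeasure ρ β : Measure (GaugeConfig 4 (2 * S + 1) G)) :=
  stub_tiltChessboardStep stub_oddRPCrossTilt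

end Summit.QuantumFields.YangMills.Cruxes.LatticeGapOnTrajectory.SparseDefectOrbitWindow

end
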